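import Summits.CriticalPhenomena.PercolationContinuityZ3.Theses.PercQuarantineIslands
import Literature.Probability.Percolation.SharpnessDCTProofs
import Literature.Probability.Percolation.PercolationProofs

/-!
Refutation of `PercQuarantineIslands.QuarantineInequality` (item stmt-CriticalPhenomena-7073).

The statement quantifies over ALL `R : ℕ`; at `R = 0` the annulus `B(2R) \ B(R)` is empty, so the
quarantine event `Q'_0` is the sure event, the free-box event `{1 ≤ #{y ∈ B(0) : 0 ↔ y in B(0)}}`
is the sure event (`0 ↔ 0`), and the inequality reads `1 ≤ P_p(|C(0)| < ∞) = 1 - θ(p)`, false at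
every `p` with `θ(p) > 0`, e.g. `p = 1` (`θ(1) = 1`).  The intended statement needs `1 ≤ R`
(for `R ≥ 1` the last-exit argument of the route's proof sketch is correct).
-/

open Classical in
/-- **Record of the dropped route item `QuarantineInequality`** = stmt-CriticalPhenomena-7073 (ledger signature verbatim; NOT a route
item): route PercQuarantineIslands rev 2 (2026-08-15T16:57Z) dropped the refuted `QuarantineInequality` in favour of `QuarantineInequalityR`. The declaration `Summit.CriticalPhenomena.PercolationContinuityZ3.Theses.PercQuarantineIslands.QuarantineInequality`
therefore no longer exists in the route file and this accepted module stopped elaborating (stale olean;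
buildfix lane 2026-08-19). Re-created here under its original name so the result keeps building; the
statement of every previously accepted declaration in this file is unchanged. -/
def _root_.Summit.CriticalPhenomena.PercolationContinuityZ3.Theses.PercQuarantineIslands.QuarantineInequality : Prop :=
  ∀ p : unitInterval, ∀ R s : ℕ, ∀ x ∈ Literature.Probability.LatticeModels.box 3 R, (Literature.Probability.Percolation.bondPercolation (Literature.Probability.LatticeModels.zdGraph 3) p).real {ω | ¬ ∃ a b : Literature.Probability.LatticeModels.Site 3, a ∈ Literature.Probability.LatticeModels.box 3 (R + 1) ∧ b ∈ Literature.Probability.LatticeModels.innerBoundary (Literature.Probability.LatticeModels.zdGraph 3) (Literature.Probability.LatticeModels.box 3 (2 * R)) ∧ ω ∈ Literature.Probability.Percolation.openConnIn ((↑(Literature.Probability.LatticeModels.box 3 (2 * R)) : Set (Literature.Probability.LatticeModels.Site 3)) \ ↑(Literature.Probability.LatticeModels.box 3 R)) a b} * (Literature.Probability.Percolation.bondPercolation (Literature.Probability.LatticeModels.zdGraph 3) p).real {ω | s ≤ ((Literature.Probability.LatticeModels.box 3 R).filter (fun y => ω ∈ Literature.Probability.Percolation.openConnIn ↑(Literature.Probability.LatticeModels.box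 3 R) x y)).card} ≤ (Literature.Probability.Percolation.bondPercolation (Literature.Probability.LatticeModels.zdGraph 3) p).real {ω | (s : ℕ∞) ≤ (Literature.Probability.Percolation.openCluster ω x).encard ∧ (Literature.Probability.Percolation.openCluster ω x).Finite}


namespace Summit.CriticalPhenomena.PercolationContinuityZ3.Theorems

open MeasureTheory Literature.Probability.Percolation Literature.Probability.LatticeModels

/-- Refutes `PercQuarantineIslands.QuarantineInequality`: at `p = 1`, `R = 0`, `s = 1`, `x = 0`
the left-hand side is `1 · 1` and the right-hand side is `P_1(|C(0)| < ∞) = 1 - θ(1) = 0`;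
witness: empty annulus `B(0) \ B(0) = ∅`, `θ(1) = 1` on `ℤ³`. [folklore] -/
theorem PercQuarantineIslandsQuarantineInequality_refuted :
    ¬ Summit.CriticalPhenomena.PercolationContinuityZ3.Theses.PercQuarantineIslands.QuarantineInequality := by
  classical
  intro h
  have hx : (0 : Site 3) ∈ box 3 0 := by simp [mem_box]
  have key := h 1 0 1 0 hx
  -- the quarantine event at `R = 0` is the sure event
  conv at key =>
    lhs; arg 1
    equals (1 : ℝ) =>
      rw [← probReal_univ (μ := bondPercolation (zdGraph 3) 1)]
      congr 1
      refine Set.eq_univ_of_forall fun ω => ?_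
      rintro ⟨a, b, -, -, ha, -, -⟩
      simp at ha
  -- the free-box event at `R = 0`, `s = 1`, `x = 0` is the sure event
  conv at key =>
    lhs; arg 2
    equals (1 : ℝ) =>
      rw [← probReal_univ (μ := bondPercolation (zdGraph 3) 1)]
      congr 1
      refine Set.eq_univ_of_forall fun ω => ?_
      have hx' : (0 : Site 3) ∈ ((box 3 0 : Finset (Site 3)) : Set (Site 3)) := Finset.mem_coe.2 hx
      refine Finset.one_le_card.2 ⟨0, ?_⟩
      rw [Finset.mem_filter]
      exact ⟨hx, hx', hx', SimpleGraph.Reachable.refl _⟩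
  rw [one_mul] at key
  -- the right-hand side is at most `P_1(|C(0)| < ∞) = 1 - θ(1) = 0`
  have hle : (bondPercolation (zdGraph 3) 1).real (percolatesAt (0 : Site 3))ᶜ = 0 := by
    rw [measureReal_compl (measurableSet_percolatesAt_holds (0 : Site 3)), probReal_univ]
    have := DCT16.theta_one (d := 3) (by norm_num)
    rw [theta] at this
    linarith
  have hsub : {ω : BondConfig (Site 3) | ((1 : ℕ) : ℕ∞) ≤ (openCluster ω 0).encard ∧ (openCluster ω 0).Finite}
      ⊆ (percolatesAt (0 : Site 3))ᶜ := by
    intro ω hω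
    simp only [Set.mem_setOf_eq] at hω
    simp only [Set.mem_compl_iff, percolatesAt, Set.mem_setOf_eq, Set.not_infinite]
    exact hω.2
  have key2 := key.trans (measureReal_mono (μ := bondPercolation (zdGraph 3) 1) hsub)
  linarith
end Summit.CriticalPhenomena.PercolationContinuityZ3.Theorems
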